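import Literature.Topology.FourManifolds.CappellShanesonClassNumbers
import Literature.NumberTheory.NumberFields.IntegralBasisCriterion
import Mathlib.NumberTheory.NumberField.ClassNumber
import Mathlib.NumberTheory.NumberField.InfinitePlace.Basic
import Mathlib.FieldTheory.PrimitiveElement
import Mathlib.RingTheory.Polynomial.GaussLemma
import Mathlib.Analysis.Real.Pi.Bounds
import Mathlib.Tactic.IntervalCases
import HarnessLib

/-!
# Class number one of the cubic orders `ℤ[θ_a]`, `-1 ≤ a ≤ 6` (Aitchison–Rubinstein, Table 1)

Third file of the discharge of the Aitchison–Rubinstein leaves of Gompf's Theorem 3.2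
(`CappellShanesonTraceClasses.lean` → `CappellShanesonClassNumbers.lean` → this file): the named
fact `aitchisonRubinstein1984_classNumberOne` — `ℤ[X]/(f_a)` is a principal ideal domain for
`-4 ≤ a ≤ 9`, i.e. rows `a ∈ [-4, 9]` of Table 1 of Aitchison–Rubinstein, Contemp. Math. 35
(1984), Appendix "Conjugacy in `SL(3, ℤ)`" (`R = R'`, `|C(R')| = 1`) — is PROVED for the eight
traces `-1 ≤ a ≤ 6` and reduced, for the remaining six, to the class-number-one rows
`Δ = 257, 697, 1489` proper (`aitchisonRubinstein1984_classNumberOne_large`, named fact).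

## What is proved, and how

For a number field `K` of degree `3` containing a root `θ` of `f_a = x³ - a x² + (a - 1) x - 1`
(hypotheses `hθ : aeval θ (csPoly a) = 0`, `h3 : finrank ℚ K = 3`; the model `ℚ[x]/(f_a)`,
`CSField a`, shows such `(K, θ)` exist):

* `csPB hθ h3`: the power basis `1, θ, θ²` (`ℚ(θ) = K` by degree count,
  `Field.primitive_element_iff_minpoly_natDegree_eq`); `minpoly_int_eq`: `minpoly_ℤ θ = f_a`
  (Gauss's lemma);
* `leftMulMatrix_theta`: multiplication by `θ` is the companion matrix `csCompanion a` of `f_a`;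
  hence `Tr(θᵏ) = tr(Cᵏ)` and, through the trace form, **`disc(1, θ, θ²) = Δ(f_a) =
  a(a-2)(a-3)(a-5) - 23`** (`discr_csPB`; Aitchison–Rubinstein: "`Δ(f_a) = a(a-2)(a-3)(a-5) - 23 =
  Δ(f_{5-a})`");
* for `-4 ≤ a ≤ 9`, `Δ(f_a) ∈ {-23, -31, 49, 257, 697, 1489}` admits no factorisation `r² e`,
  `|e| > 2`, `r ≠ ±1` (`csDisc_sq_factor`, a finite check), so by the discriminant–index criterion
  (`Literature.NumberTheory.NumberFields.isUnit_indexDet_of_discr_eq`, Marcus Ch. 2 Ex. 27 with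
  Hermite–Minkowski) **`𝓞 K = ℤ[θ]`** (`mem_adjoin_theta`; Table 1's column "`R = R'`": YES) and
  **`d_K = Δ(f_a)`** (`discr_eq_csDisc`);
* for `-1 ≤ a ≤ 6`, `|d_K| ≤ 49 < (9π/4)² ≤ (2 (π/4)^{r₂} 3³/3!)²`, so Mathlib's
  `RingOfIntegers.isPrincipalIdealRing_of_abs_discr_lt` gives **`𝓞 K` principal**
  (`isPrincipalIdealRing_ringOfIntegers`; Aitchison–Rubinstein: "For `0 ≤ a ≤ 5`, `Δ(f_a)` is
  prime, and `|Δ(f_a)| < 36`. Thus … `R'_a = ℤ[θ_a]` and … the Minkowski Bound gives …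
  `< 2`. Hence `C(R'_a)` is trivial"; the rows `a = 6, -1`, `Δ = 49`, are covered by the same
  bound);
* transfer to `ℤ[X]/(f_a) ≅ ℤ[θ] = 𝓞 K`
  (`Literature.NumberTheory.NumberFields.isPrincipalIdealRing_adjoinRoot_minpoly_of_isUnit_indexDet`):
  `isPrincipalIdealRing_adjoinRoot_csPoly` for `-1 ≤ a ≤ 6`, and
  `aitchisonRubinstein1984_classNumberOne_of_large`, `aitchisonRubinstein1984_uniqueTraceClass_of_large`.

## What remains (the named fact)

`aitchisonRubinstein1984_classNumberOne_large`: for `a ∈ {7, -2}` (`Δ = 257`), `{8, -3}`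
(`Δ = 697`), `{9, -4}` (`Δ = 1489`) the ring of integers of a cubic field generated by a root of
`f_a` is principal (Table 1: `|C(R')| = 1`, read off Borevich–Shafarevich). Here the Minkowski
bound exceeds `2` (`⌊M_K⌋ = 3, 5, 8` for the totally real signature), so the primes above `2, 3`
(resp. `≤ 5`, `≤ 7`) must be shown principal
(`RingOfIntegers.isPrincipalIdealRing_of_isPrincipal_of_pow_le_of_mem_primesOver_of_mem_Icc`);
not attempted here.

## References

* [AitchisonRubinstein1984] I. R. Aitchison, J. H. Rubinstein, *Fibered knots and involutions on
  homotopy spheres*, Contemp. Math. 35 (1984) 1–74, Appendix "Conjugacy in `SL(3, ℤ)`": the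
  discriminant formula, Table 1, and the Minkowski-bound paragraph following it.
* [Marcus2018] D. A. Marcus, *Number Fields*, 2nd ed. (2018), Ch. 2, Exercise 27; Ch. 5, Cor. 2
  of Thm. 37 (Minkowski's constant).
-/
noncomputable section

open Set Polynomial Module NumberField IntermediateField
open scoped NumberField IntermediateField

namespace Literature.Topology.FourManifolds

/-! ### `f_a` over `ℚ` -/

/-- `f_a` over `ℚ`. [folklore] -/
def csPolyQ (a : ℤ) : ℚ[X] := (csPoly a).map (algebraMap ℤ ℚ)

/-- `f_a` over `ℚ`, written out. [folklore] -/
theorem csPolyQ_eq (a : ℤ) : csPolyQ a = X ^ 3 - C (a : ℚ) * X ^ 2 + C ((a : ℚ) - 1) * X - 1 := by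
  simp [csPolyQ, csPoly, Polynomial.map_sub, Polynomial.map_add, Polynomial.map_mul]

/-- `f_a` over `ℚ` is monic. [folklore] -/
theorem monic_csPolyQ (a : ℤ) : (csPolyQ a).Monic := (monic_csPoly a).map _

/-- `f_a` over `ℚ` has degree `3`. [folklore] -/
theorem natDegree_csPolyQ (a : ℤ) : (csPolyQ a).natDegree = 3 := by
  rw [csPolyQ, (monic_csPoly a).natDegree_map, natDegree_csPoly]

/-- `f_a` is irreducible over `ℚ` (Gauss's lemma and `irreducible_csPoly`, Aitchison–Rubinstein's
Lemma A4). [cite: AitchisonRubinstein1984, Appendix, Lemma A4] -/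
theorem irreducible_csPolyQ (a : ℤ) : Irreducible (csPolyQ a) :=
  ((monic_csPoly a).isPrimitive.irreducible_iff_irreducible_map_fraction_map (K := ℚ)).mp
    (irreducible_csPoly a)

/-- **The discriminant of `f_a`**: `Δ(f_a) = a(a-2)(a-3)(a-5) - 23` (`= a⁴ - 10a³ + 31a² - 30a - 23`;
Aitchison–Rubinstein, Appendix: "`Δ(f_a) = a(a-2)(a-3)(a-5) - 23 = Δ(f_{5-a})` and thus values
for the discriminant occur in pairs"). [cite: AitchisonRubinstein1984, Appendix (discriminant of f_a, before Table 1)] -/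
def csDisc (a : ℤ) : ℤ := a * (a - 2) * (a - 3) * (a - 5) - 23

/-- The companion matrix of `f_a` (matrix of multiplication by `θ` in the basis `1, θ, θ²`,
columns = coordinates of `θ, θ², θ³ = 1 - (a - 1) θ + a θ²`). [folklore] -/
def csCompanion (a : ℤ) : Matrix (Fin 3) (Fin 3) ℚ :=
  !![0, 0, 1; 1, 0, -((a : ℚ) - 1); 0, 1, (a : ℚ)]

/-! ### A cubic number field generated by a root of `f_a` -/

section Root

variable {K : Type*} [Field K] [NumberField K] {a : ℤ} {θ : K}

/-- A root of `f_a` is a root of `f_a` over `ℚ`. [folklore] -/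
theorem aeval_csPolyQ (hθ : aeval θ (csPoly a) = 0) : aeval θ (csPolyQ a) = 0 := by
  rw [csPolyQ, aeval_map_algebraMap]
  exact hθ

omit [NumberField K] in
/-- A root of the monic integer polynomial `f_a` is an algebraic integer. [folklore] -/
theorem isIntegral_of_aeval_csPoly (hθ : aeval θ (csPoly a) = 0) : IsIntegral ℤ θ :=
  ⟨csPoly a, monic_csPoly a, hθ⟩

/-- The minimal polynomial over `ℚ` of a root of `f_a` is `f_a` (irreducibility). [cite: AitchisonRubinstein1984, Appendix, Lemma A4] -/
theorem minpoly_rat_eq (hθ : aeval θ (csPoly a) = 0) : minpoly ℚ θ = csPolyQ a :=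
  (minpoly.eq_of_irreducible_of_monic (irreducible_csPolyQ a) (aeval_csPolyQ hθ)
    (monic_csPolyQ a)).symm

/-- The minimal polynomial over `ℤ` of a root of `f_a` is `f_a` (integrally closed base:
`minpoly_ℚ = map minpoly_ℤ`). [cite: AitchisonRubinstein1984, Appendix, Lemma A4] -/
theorem minpoly_int_eq (hθ : aeval θ (csPoly a) = 0) : minpoly ℤ θ = csPoly a := by
  apply Polynomial.map_injective (algebraMap ℤ ℚ) (algebraMap ℤ ℚ).injective_int
  rw [← minpoly.isIntegrallyClosed_eq_field_fractions' ℚ (isIntegral_of_aeval_csPoly hθ),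
    minpoly_rat_eq hθ]
  rfl

/-- A root of `f_a` generates a cubic field containing it: `ℚ(θ) = K` when `[K : ℚ] = 3`
(`deg minpoly θ = [K : ℚ]`). [folklore] -/
theorem adjoin_root_eq_top (hθ : aeval θ (csPoly a) = 0) (h3 : finrank ℚ K = 3) :
    ℚ⟮θ⟯ = ⊤ :=
  (Field.primitive_element_iff_minpoly_natDegree_eq ℚ θ).mpr
    (by rw [minpoly_rat_eq hθ, natDegree_csPolyQ, h3])

/-- The power basis `1, θ, θ²` of `K = ℚ(θ)` (from `IntermediateField.adjoin.powerBasis`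
transported along `ℚ(θ) = ⊤ ≃ K`). [folklore] -/
def csPB (hθ : aeval θ (csPoly a) = 0) (h3 : finrank ℚ K = 3) : PowerBasis ℚ K :=
  (adjoin.powerBasis (isIntegral_of_aeval_csPoly hθ).tower_top).map
    ((equivOfEq (adjoin_root_eq_top hθ h3)).trans topEquiv)

/-- The generator of `csPB` is `θ`. [folklore] -/
theorem csPB_gen (hθ : aeval θ (csPoly a) = 0) (h3 : finrank ℚ K = 3) : (csPB hθ h3).gen = θ :=
  rfl

/-- `csPB` has dimension `3`. [folklore] -/
theorem csPB_dim (hθ : aeval θ (csPoly a) = 0) (h3 : finrank ℚ K = 3) : (csPB hθ h3).dim = 3 := by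
  rw [csPB, PowerBasis.map_dim, adjoin.powerBasis_dim, minpoly_rat_eq hθ, natDegree_csPolyQ]

/-- The basis `1, θ, θ²`, indexed by `Fin 3`. [folklore] -/
def csBasis (hθ : aeval θ (csPoly a) = 0) (h3 : finrank ℚ K = 3) : Basis (Fin 3) ℚ K :=
  (csPB hθ h3).basis.reindex (finCongr (csPB_dim hθ h3))

/-- `csBasis i = θ ^ i`. [folklore] -/
theorem csBasis_apply (hθ : aeval θ (csPoly a) = 0) (h3 : finrank ℚ K = 3) (i : Fin 3) :
    csBasis hθ h3 i = θ ^ (i : ℕ) := by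
  rw [csBasis, Basis.reindex_apply, (csPB hθ h3).coe_basis, csPB_gen]
  rfl

/-- The cubic relation `θ³ = 1 - (a - 1) θ + a θ²` in the basis `1, θ, θ²`. [folklore] -/
theorem pow_three_eq (hθ : aeval θ (csPoly a) = 0) (h3 : finrank ℚ K = 3) :
    θ ^ 3 = (1 : ℚ) • csBasis hθ h3 0 + (-((a : ℚ) - 1)) • csBasis hθ h3 1 +
      (a : ℚ) • csBasis hθ h3 2 := by
  have h : θ ^ 3 - (a : K) * θ ^ 2 + ((a : K) - 1) * θ - 1 = 0 := by
    have := hθ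
    simp only [csPoly, map_sub, map_add, map_mul, map_pow, aeval_X, map_one, eq_intCast,
      map_intCast] at this
    linear_combination this
  simp only [csBasis_apply, Fin.val_zero, Fin.val_one, Fin.val_two, pow_zero, pow_one,
    Algebra.smul_def, map_one, map_neg, map_sub, map_intCast]
  linear_combination h

/-- Coordinates of `θ` in `1, θ, θ²`. [folklore] -/
theorem repr_pow_one (hθ : aeval θ (csPoly a) = 0) (h3 : finrank ℚ K = 3) :
    (csBasis hθ h3).repr (θ ^ 1) = Finsupp.single 1 1 := by
  rw [show θ ^ 1 = csBasis hθ h3 1 by rw [csBasis_apply]; rfl, Basis.repr_self]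

/-- Coordinates of `θ²` in `1, θ, θ²`. [folklore] -/
theorem repr_pow_two (hθ : aeval θ (csPoly a) = 0) (h3 : finrank ℚ K = 3) :
    (csBasis hθ h3).repr (θ ^ 2) = Finsupp.single 2 1 := by
  rw [show θ ^ 2 = csBasis hθ h3 2 by rw [csBasis_apply]; rfl, Basis.repr_self]

/-- Coordinates of `θ³ = 1 - (a - 1) θ + a θ²` in `1, θ, θ²`. [folklore] -/
theorem repr_pow_three (hθ : aeval θ (csPoly a) = 0) (h3 : finrank ℚ K = 3) :
    (csBasis hθ h3).repr (θ ^ 3) =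
      Finsupp.single 0 1 + Finsupp.single 1 (-((a : ℚ) - 1)) + Finsupp.single 2 (a : ℚ) := by
  rw [pow_three_eq hθ h3]
  simp only [map_add, map_smul, Basis.repr_self, Finsupp.smul_single_one]

/-- Multiplication by `θ` has matrix `csCompanion a` in the basis `1, θ, θ²`. [folklore] -/
theorem leftMulMatrix_theta (hθ : aeval θ (csPoly a) = 0) (h3 : finrank ℚ K = 3) :
    Algebra.leftMulMatrix (csBasis hθ h3) θ = csCompanion a := by
  ext i j
  rw [Algebra.leftMulMatrix_eq_repr_mul, csBasis_apply, ← pow_succ']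
  fin_cases j
  · change ((csBasis hθ h3).repr (θ ^ 1)) i = csCompanion a i 0
    rw [repr_pow_one]
    fin_cases i <;> simp [csCompanion]
  · change ((csBasis hθ h3).repr (θ ^ 2)) i = csCompanion a i 1
    rw [repr_pow_two]
    fin_cases i <;> simp [csCompanion]
  · change ((csBasis hθ h3).repr (θ ^ 3)) i = csCompanion a i 2
    rw [repr_pow_three]
    fin_cases i <;> simp [csCompanion]

/-- `Tr(θᵏ) = tr(Cᵏ)`. [folklore] -/
theorem trace_theta_pow (hθ : aeval θ (csPoly a) = 0) (h3 : finrank ℚ K = 3) (k : ℕ) :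
    Algebra.trace ℚ K (θ ^ k) = Matrix.trace (csCompanion a ^ k) := by
  rw [Algebra.trace_eq_matrix_trace (csBasis hθ h3), map_pow, leftMulMatrix_theta]

/-- **`disc(1, θ, θ²) = Δ(f_a)`**, computed as the determinant of the trace form
`(Tr θ^{i+j})_{i,j ≤ 2}` with `Tr θᵏ = tr Cᵏ`. [cite: AitchisonRubinstein1984, Appendix (discriminant of f_a, before Table 1)] -/
theorem discr_csBasis (hθ : aeval θ (csPoly a) = 0) (h3 : finrank ℚ K = 3) :
    Algebra.discr ℚ ⇑(csBasis hθ h3) = (csDisc a : ℚ) := by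
  rw [Algebra.discr_def, Matrix.det_fin_three]
  simp only [Algebra.traceMatrix_apply, Algebra.traceForm_apply, csBasis_apply, ← pow_add,
    trace_theta_pow hθ h3]
  simp [csCompanion, pow_succ, Matrix.trace_fin_three, csDisc]
  ring

/-- **`disc(1, θ, θ²) = Δ(f_a)`** for the power basis `csPB`
(Aitchison–Rubinstein: "`Δ(f_a) = a(a-2)(a-3)(a-5) - 23`"). [cite: AitchisonRubinstein1984, Appendix (discriminant of f_a, before Table 1)] -/
theorem discr_csPB (hθ : aeval θ (csPoly a) = 0) (h3 : finrank ℚ K = 3) :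
    Algebra.discr ℚ ⇑(csPB hθ h3).basis = (csDisc a : ℚ) := by
  rw [← discr_csBasis hθ h3, csBasis, Basis.coe_reindex, Algebra.discr_reindex]

/-! ### The arithmetic of `Δ(f_a)` for `-4 ≤ a ≤ 9` -/

omit [NumberField K] in
/-- A finite check certifying "every factorisation `d = r² e` with `|e| > 2` has `r = ±1`": it
suffices that `d ≠ 0` and that no `n` with `2 ≤ n ≤ B`, where `|d| < (B + 1)²`, has `n² ∣ |d|`
and `|d| > 2 n²`. [folklore] -/
theorem isUnit_of_eq_sq_mul {d : ℤ} {B : ℕ} (hd : d ≠ 0) (hB : d.natAbs < (B + 1) * (B + 1))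
    (H : ∀ n ∈ Finset.Icc 2 B, n * n ∣ d.natAbs → d.natAbs ≤ 2 * (n * n)) :
    ∀ r e : ℤ, d = r ^ 2 * e → 2 < |e| → IsUnit r := by
  intro r e hre he
  rw [Int.isUnit_iff_natAbs_eq]
  by_contra hr1
  have hr0 : r ≠ 0 := by
    rintro rfl
    simp only [ne_eq, zero_pow, OfNat.ofNat_ne_zero, not_false_eq_true, zero_mul] at hre
    exact hd hre
  have hn0 : r.natAbs ≠ 0 := Int.natAbs_ne_zero.mpr hr0
  set n := r.natAbs with hn
  have hn2 : 2 ≤ n := by omega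
  have he3 : 3 ≤ e.natAbs := by
    have : (2 : ℤ) < (e.natAbs : ℤ) := by rwa [Int.natCast_natAbs]
    omega
  have hdabs : d.natAbs = n * n * e.natAbs := by
    rw [hre, Int.natAbs_mul, Int.natAbs_pow, pow_two]
  have hnn : n * n ≤ d.natAbs := by
    rw [hdabs]
    exact Nat.le_mul_of_pos_right _ (by omega)
  have hnB : n ≤ B := by
    by_contra h
    have h' : B + 1 ≤ n := by omega
    have : (B + 1) * (B + 1) ≤ n * n := Nat.mul_le_mul h' h'
    omega
  have key := H n (Finset.mem_Icc.mpr ⟨hn2, hnB⟩) ⟨e.natAbs, by rw [hdabs]⟩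
  rw [hdabs] at key
  nlinarith

omit [NumberField K] in
/-- For `-4 ≤ a ≤ 9`, `Δ(f_a) ∈ {-23, -31, 49, 257, 697, 1489}` admits no factorisation
`Δ = r² e` with `|e| > 2` and `r ≠ ±1` (the values are squarefree except `49 = 7² · 1`;
Aitchison–Rubinstein, Table 1, column "Prime factors"). [cite: AitchisonRubinstein1984, Appendix, Table 1] -/
theorem csDisc_sq_factor (ha : a ∈ Icc (-4 : ℤ) 9) :
    ∀ r e : ℤ, csDisc a = r ^ 2 * e → 2 < |e| → IsUnit r := by
  simp only [mem_Icc] at ha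
  obtain ⟨h1, h2⟩ := ha
  interval_cases a <;>
    exact isUnit_of_eq_sq_mul (B := 38) (by decide) (by decide) (by decide)

/-! ### `𝓞 K = ℤ[θ]`, the discriminant, and class number one for `-1 ≤ a ≤ 6` -/

/-- The generator of `csPB` is integral. [folklore] -/
theorem isIntegral_csPB_gen (hθ : aeval θ (csPoly a) = 0) (h3 : finrank ℚ K = 3) :
    IsIntegral ℤ (csPB hθ h3).gen :=
  isIntegral_of_aeval_csPoly hθ

/-- For `-4 ≤ a ≤ 9` the index determinant of `1, θ, θ²` is a unit (discriminant–index criterion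
with `csDisc_sq_factor`): `1, θ, θ²` is an integral basis. [cite: AitchisonRubinstein1984, Appendix, Table 1 (column R = R')] -/
theorem isUnit_indexDet_csPB (hθ : aeval θ (csPoly a) = 0) (h3 : finrank ℚ K = 3)
    (ha : a ∈ Icc (-4 : ℤ) 9) :
    IsUnit (Literature.NumberTheory.NumberFields.indexDet (csPB hθ h3) (isIntegral_csPB_gen hθ h3)) :=
  Literature.NumberTheory.NumberFields.isUnit_indexDet_of_discr_eq (csPB hθ h3)
    (isIntegral_csPB_gen hθ h3) (by rw [h3]; norm_num) (csDisc a) (discr_csPB hθ h3)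
    (csDisc_sq_factor ha)

/-- **`𝓞 K = ℤ[θ]` (proved)** for a cubic field generated by a root `θ` of `f_a`, `-4 ≤ a ≤ 9`:
every algebraic integer of `K` lies in `ℤ[θ]` (Aitchison–Rubinstein, Table 1, column "`R = R'`":
YES for these rows). [cite: AitchisonRubinstein1984, Appendix, Table 1 (column R = R')] -/
theorem mem_adjoin_theta (hθ : aeval θ (csPoly a) = 0) (h3 : finrank ℚ K = 3)
    (ha : a ∈ Icc (-4 : ℤ) 9) (x : 𝓞 K) : (x : K) ∈ Algebra.adjoin ℤ ({θ} : Set K) :=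
  Literature.NumberTheory.NumberFields.mem_adjoin_of_isUnit_indexDet (csPB hθ h3)
    (isIntegral_csPB_gen hθ h3) (isUnit_indexDet_csPB hθ h3 ha) x

/-- **`d_K = Δ(f_a)` (proved)** for such a field (`-4 ≤ a ≤ 9`): Table 1, columns `Δ(f_a)` and
`R = R'`. [cite: AitchisonRubinstein1984, Appendix, Table 1] -/
theorem discr_eq_csDisc (hθ : aeval θ (csPoly a) = 0) (h3 : finrank ℚ K = 3)
    (ha : a ∈ Icc (-4 : ℤ) 9) : NumberField.discr K = csDisc a :=
  Literature.NumberTheory.NumberFields.discr_eq_of_isUnit_indexDet (csPB hθ h3)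
    (isIntegral_csPB_gen hθ h3) (isUnit_indexDet_csPB hθ h3 ha) (csDisc a) (discr_csPB hθ h3)

omit [NumberField K] in
/-- `|Δ(f_a)| ≤ 49` for `-1 ≤ a ≤ 6` (`Δ = 49, -23, -31, -23, -23, -31, -23, 49`). [cite: AitchisonRubinstein1984, Appendix, Table 1] -/
theorem natAbs_csDisc_le (ha : a ∈ Icc (-1 : ℤ) 6) : (csDisc a).natAbs ≤ 49 := by
  simp only [mem_Icc] at ha
  obtain ⟨h1, h2⟩ := ha
  interval_cases a <;> decide

/-- **Class number one for `-1 ≤ a ≤ 6` (proved)**: the ring of integers of a cubic field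
generated by a root of `f_a` is principal (Aitchison–Rubinstein, Table 1: `a ∈ [0, 5]`,
`Δ = -23, -31`: "For `0 ≤ a ≤ 5`, `Δ(f_a)` is prime, and `|Δ(f_a)| < 36`. Thus … `R'_a = ℤ[θ_a]`
and since `s = 1` the Minkowski Bound gives … `< 2`. Hence `C(R'_a)` is trivial"; `a = 6, -1`,
`Δ = 49`, `|C(R')| = 1`). Proof: `|d_K| = |Δ(f_a)| ≤ 49 < (9π/4)² ≤ (2 (π/4)^{r₂} 3³/3!)²` for
`r₂ ≤ 1`, and Mathlib's `RingOfIntegers.isPrincipalIdealRing_of_abs_discr_lt` (every ideal class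
contains an ideal of norm `1`). [cite: AitchisonRubinstein1984, Appendix, Table 1 and the Minkowski-bound paragraph] -/
theorem isPrincipalIdealRing_ringOfIntegers (hθ : aeval θ (csPoly a) = 0) (h3 : finrank ℚ K = 3)
    (ha : a ∈ Icc (-1 : ℤ) 6) : IsPrincipalIdealRing (𝓞 K) := by
  have ha' : a ∈ Icc (-4 : ℤ) 9 := by
    simp only [mem_Icc] at ha ⊢
    omega
  have hc : NumberField.InfinitePlace.nrComplexPlaces K ≤ 1 := by
    have := NumberField.InfinitePlace.card_add_two_mul_card_eq_rank K
    rw [h3] at this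
    omega
  have hd : ((|NumberField.discr K| : ℤ) : ℝ) ≤ 49 := by
    rw [discr_eq_csDisc hθ h3 ha', Int.abs_eq_natAbs]
    exact_mod_cast natAbs_csDisc_le ha
  apply RingOfIntegers.isPrincipalIdealRing_of_abs_discr_lt
  rw [h3]
  refine lt_of_le_of_lt hd ?_
  have hpi : (3.14 : ℝ) < Real.pi := Real.pi_gt_d2
  interval_cases h : NumberField.InfinitePlace.nrComplexPlaces K
  · norm_num [Nat.factorial]
  · norm_num [Nat.factorial]
    nlinarith [hpi, Real.pi_pos]

/-- **From class number one of `K` to `ℤ[X]/(f_a)` principal** (`-4 ≤ a ≤ 9`): since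
`𝓞 K = ℤ[θ] ≅ ℤ[X]/(f_a)` (`minpoly_ℤ θ = f_a`), a principal `𝓞 K` makes `AdjoinRoot (csPoly a)`
a principal ideal ring ("`R = R'`" and "`|C(R')| = 1`" together). [cite: AitchisonRubinstein1984, Appendix, Table 1] -/
theorem isPrincipalIdealRing_adjoinRoot_csPoly_of_ringOfIntegers (hθ : aeval θ (csPoly a) = 0)
    (h3 : finrank ℚ K = 3) (ha : a ∈ Icc (-4 : ℤ) 9) (hK : IsPrincipalIdealRing (𝓞 K)) :
    IsPrincipalIdealRing (AdjoinRoot (csPoly a)) := by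
  rw [← minpoly_int_eq hθ]
  exact Literature.NumberTheory.NumberFields.isPrincipalIdealRing_adjoinRoot_minpoly_of_isUnit_indexDet
    (csPB hθ h3) (isIntegral_csPB_gen hθ h3) (isUnit_indexDet_csPB hθ h3 ha)

end Root

/-! ### The model `ℚ[x]/(f_a)` -/

section Model

/-- `f_a` is irreducible over `ℚ`, as a `Fact` (so that `ℚ[x]/(f_a)` is a field). [folklore] -/
instance fact_irreducible_csPolyQ (a : ℤ) : Fact (Irreducible (csPolyQ a)) := ⟨irreducible_csPolyQ a⟩

/-- The cubic number field `K_a = ℚ[x]/(f_a)`. [folklore] -/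
abbrev CSField (a : ℤ) : Type := AdjoinRoot (csPolyQ a)

/-- `ℚ[x]/(f_a)` is a number field (finite-dimensional over `ℚ` by the power basis; the
`ℚ`-algebra structures involved agree by `subsingleton_rat_module`). [folklore] -/
instance numberField_CSField (a : ℤ) : NumberField (CSField a) where
  to_charZero := charZero_of_injective_algebraMap (algebraMap ℚ (CSField a)).injective
  to_finiteDimensional := by
    convert (AdjoinRoot.powerBasis' (monic_csPolyQ a)).finite

/-- The class of `x` in `ℚ[x]/(f_a)` is a root of `f_a`. [folklore] -/
theorem aeval_root_csPoly (a : ℤ) : aeval (AdjoinRoot.root (csPolyQ a)) (csPoly a) = 0 := by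
  have h : ((csPoly a).map (algebraMap ℤ ℚ)).eval₂ (AdjoinRoot.of (csPolyQ a))
      (AdjoinRoot.root (csPolyQ a)) = 0 :=
    AdjoinRoot.eval₂_root (csPolyQ a)
  rw [eval₂_map] at h
  rwa [aeval_def, Subsingleton.elim (algebraMap ℤ (CSField a))
    ((AdjoinRoot.of (csPolyQ a)).comp (algebraMap ℤ ℚ))]

/-- `[ℚ[x]/(f_a) : ℚ] = 3`. [folklore] -/
theorem finrank_CSField (a : ℤ) : finrank ℚ (CSField a) = 3 := by
  have h := (AdjoinRoot.powerBasis' (monic_csPolyQ a)).finrank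
  rw [AdjoinRoot.powerBasis'_dim, natDegree_csPolyQ] at h
  convert h

end Model

/-! ### Assembly: Table 1 for `-4 ≤ a ≤ 9` -/

/-- **`ℤ[θ_a] = ℤ[X]/(f_a)` is a principal ideal domain for `-1 ≤ a ≤ 6` (proved)** — rows
`a ∈ [-1, 6]` of Table 1 (`R = R'`, `|C(R')| = 1`), through the model `ℚ[x]/(f_a)`. [cite: AitchisonRubinstein1984, Appendix, Table 1] -/
theorem isPrincipalIdealRing_adjoinRoot_csPoly {a : ℤ} (ha : a ∈ Icc (-1 : ℤ) 6) :
    IsPrincipalIdealRing (AdjoinRoot (csPoly a)) :=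
  isPrincipalIdealRing_adjoinRoot_csPoly_of_ringOfIntegers (K := CSField a) (aeval_root_csPoly a)
    (finrank_CSField a) (by simp only [mem_Icc] at ha ⊢; omega)
    (isPrincipalIdealRing_ringOfIntegers (aeval_root_csPoly a) (finrank_CSField a) ha)

/-- **Aitchison–Rubinstein 1984, Table 1, rows `a = 7, -2` (`Δ = 257`), `8, -3` (`Δ = 697 = 17·41`),
`9, -4` (`Δ = 1489`): class number one (named fact).** For these traces the table gives
`|C(R')| = 1` ("read off … Table 7, p. 428 of Borevich and Shafarevich") with `R = R'`; the
latter is PROVED above (`mem_adjoin_theta`), so what remains is exactly: the ring of integers of a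
cubic number field generated by a root of `f_a` is principal. (The Minkowski bound is `> 2` here,
so prime ideals of norm `≤ 3, 5, 8` respectively have to be shown principal; not attempted.) Users
take `(h : aitchisonRubinstein1984_classNumberOne_large)`. [cite: AitchisonRubinstein1984, Appendix, Table 1 (rows a = 7,-2; 8,-3; 9,-4)] -/
def aitchisonRubinstein1984_classNumberOne_large : Prop :=
  ∀ a ∈ ({-4, -3, -2, 7, 8, 9} : Finset ℤ), ∀ (K : Type) [Field K] [NumberField K] (θ : K),
    aeval θ (csPoly a) = 0 → finrank ℚ K = 3 → IsPrincipalIdealRing (𝓞 K)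

/-- **Table 1 for `-4 ≤ a ≤ 9` from its three unproved rows**: the named fact
`aitchisonRubinstein1984_classNumberOne` (`ℤ[X]/(f_a)` principal for all `a ∈ [-4, 9]`) follows
from `aitchisonRubinstein1984_classNumberOne_large`, the eight traces `-1 ≤ a ≤ 6` being proved
(`isPrincipalIdealRing_adjoinRoot_csPoly`). [cite: AitchisonRubinstein1984, Appendix, Table 1] -/
theorem aitchisonRubinstein1984_classNumberOne_of_large
    (h : aitchisonRubinstein1984_classNumberOne_large) : aitchisonRubinstein1984_classNumberOne := by
  intro a ha
  by_cases h' : a ∈ Icc (-1 : ℤ) 6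
  · exact isPrincipalIdealRing_adjoinRoot_csPoly h'
  · have hmem : a ∈ ({-4, -3, -2, 7, 8, 9} : Finset ℤ) := by
      simp only [mem_Icc, not_and_or, not_le] at ha h'
      simp only [Finset.mem_insert, Finset.mem_singleton]
      omega
    exact isPrincipalIdealRing_adjoinRoot_csPoly_of_ringOfIntegers (K := CSField a)
      (aeval_root_csPoly a) (finrank_CSField a) ha
      (h a hmem (CSField a) (AdjoinRoot.root (csPolyQ a)) (aeval_root_csPoly a) (finrank_CSField a))

/-- Hence the uniqueness of the conjugacy class of Cappell–Shaneson matrices of trace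
`a ∈ [-4, 9]` (`aitchisonRubinstein1984_uniqueTraceClass`, Gompf 2010 §3: "The class is unique when
`-4 ≤ tr(A) ≤ 9`") rests on the three class-number-one rows only. [cite: GompfAGT2010, §3] -/
theorem aitchisonRubinstein1984_uniqueTraceClass_of_large
    (h : aitchisonRubinstein1984_classNumberOne_large) : aitchisonRubinstein1984_uniqueTraceClass :=
  aitchisonRubinstein1984_uniqueTraceClass_of_classNumberOne
    (aitchisonRubinstein1984_classNumberOne_of_large h)


end Literature.Topology.FourManifolds

end
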